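/-
Copyright (c) 2026 the pub-hodgecm-mathlib formalisation cell (harness21).  Prover seat hodgecm-mathlib-K2E4-p10 (g7), Track B ∕ K2-LIT, h413 = `stmt-HodgeConjecture-24833`,
line `K2_E1_TraceFormulaBeta`, 5Res ROADCARD §3′ D4′c (SD) at GENERAL `(U, τ)` (AMENDMENT #3, `dim V(χ,K′,ω) > 1`): the «ENTRIES ⇒ OPERATOR» engine for the span model
`W = span {v_a}` with `v` LINEARLY INDEPENDENT (not orthonormal) — existence ∕ uniqueness of the operator with prescribed entries `⟪v_b, M v_a⟫`, sesquilinear identities and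
continuity read off the entries.  Mathlib only.
-/
import Mathlib.Analysis.InnerProductSpace.PiL2
import Mathlib.LinearAlgebra.Basis.Bilinear
import Mathlib.Topology.Algebra.Module.FiniteDimension
import HarnessLib

/-!
# D4′c (SD), general rank — `K2E1SpanOperatorOfEntries`: the operator on `W = span {v_a}` with prescribed entries `⟪v_b, M v_a⟫_W = β(a, b)` for a LINEARLY INDEPENDENT finite family `v`

Track B ∕ K2-LIT, crux h413 = `stmt-HodgeConjecture-24833`, route of record `HCCMUnconditional`; cell `hodgecm-mathlib`, squad K2, ENGINE E1.  THEOREMS ONLY (no `def`, no `instance`, no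
`notation`, no named-fact hypothesis, no `sorry`; default heartbeats); lane `--supports stmt-HodgeConjecture-24833 --as helper` (count-neutral).  Mathlib only.
WHY.  The self-dual block isometry ★ `exists_linearIsometry_chiSection_selfDual_cm_two` (★ p860386 :184) takes the intertwining datum as an operator family
`M : ℂ → W →ₗ[ℂ] W` on the model space `W = span {v_a} ≤ L²(K_U)` (`v_a = [φ_a|_{K_U}]`, in general NOT orthonormal: `⟪v_b, v_a⟫ = ∫_{K_U} φ_a·conj φ_b`), while its analytic payers
(★ p860772 `chiPseudoEisenstein_inner_product_selfDual_vectorGram_cm_two`, the MS entry letters, the conj∕FE chains) deliver the ENTRIES `B_z(φ_a, φ_b)`.  At M1 the block has rank one and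
`M(z) = s(z)•id` (ruling (263)); at general `(U, τ)` one needs: an operator with PRESCRIBED ENTRIES against a linearly independent family (★ p860415 §0 `exists_linearMap_inner_basis_eq`
does this for an ORTHONORMAL basis only), its uniqueness, and the transfer of entrywise identities ∕ continuity to the operator letters `hadj`, `hRsymm`, `hcont` of ★ :184.
THE MATHEMATICS (linear algebra, folklore; [HornJohnson2013, §0.6, Thm. 7.2.10]; [MoeglinWaldspurger1995, IV.1.11] for the use).  For `v : α → E` linearly independent in a complex
inner-product space, `W := span {v_a}` has basis `v` (Mathlib `Basis.span`), and the ENTRIES MAP `Φ : W → ℂ^α`, `Φ(u)_b = ⟪v_b, u⟫`, is injective (`u ⊥ v_b ∀ b ⇒ u ⊥ W ∋ u ⇒ u = 0`) hence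
bijective (`dim W = |α|`).  So for every matrix `β` there is a UNIQUE `M ∈ End W` with `⟪v_b, M v_a⟫ = β(a,b)` (`M v_a := Φ⁻¹(β(a,·))`, extended by the basis); two sesquilinear forms
agreeing on the pairs `(v_b, v_a)` agree (Mathlib `LinearMap.ext_basis`), whence `⟪u, M u′⟫ = ⟪N u, u′⟫` for all `u, u′` as soon as it holds on entries; and `x ↦ M_x u` is continuous as
soon as all entries `x ↦ ⟪v_b, M_x v_a⟫` are (`M_x v_a = Φ⁻¹(entries)`, `Φ⁻¹` continuous, `u = Σ c_a v_a`).
* §1 `eq_zero_of_inner_span_eq_zero`, **`exists_entriesEquiv`** (`Φ : W ≃ₗ[ℂ] (α → ℂ)`, `Φ u b = ⟪v_b, u⟫`).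
* §2 **`exists_linearMap_span_of_entries`**, **`eq_of_span_entries_eq`**, `exists_family_span_of_entries` (a family `x ↦ M_x` with prescribed entries `β_x` — HOW `M z` IS DEFINED at
  general rank: `obtain ⟨M, hM⟩ := exists_family_span_of_entries hv (fun z a b => B_z(φ_a, φ_b))`).
* §3 **`inner_map_eq_inner_map_of_span_entries`** (sesquilinear-by-entries) and the ★ :184 letter shapes `hadj_of_span_entries`, `hRsymm_of_span_entries`.
* §4 **`continuous_apply_of_span_entries`** and the ★ :184 letter shape `hcont_of_span_entries`.
HONEST LABEL: HC_CM is proved only modulo the 7 printed citations (2 remaining named inputs: hLiu418 = `stmt-HodgeConjecture-24832`, h413 = `stmt-HodgeConjecture-24833`) until rung 0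
closes; this file asserts no named fact, closes no socket; count-neutral; Mathlib-only linear algebra.

## References
* [HornJohnson2013] R. A. Horn, C. R. Johnson, *Matrix Analysis* (2nd ed., 2013), §0.6 (bases and coordinates), Thm. 7.2.10 (Gram matrices).
* [MoeglinWaldspurger1995] C. Mœglin, J.-L. Waldspurger, *Spectral decomposition and Eisenstein series* (1995), IV.1.11.
-/

set_option autoImplicit false
set_option linter.dupNamespace false  -- the mandated namespace repeats the summit's segment (`HodgeConjecture.HodgeConjecture`)

noncomputable section

open Complex Module
open scoped InnerProductSpace ComplexConjugate BigOperators

namespace Summit.HodgeConjecture.HodgeConjecture.Cruxes.H413.K2E1SpanOperatorOfEntries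

variable {E : Type*} [NormedAddCommGroup E] [InnerProductSpace ℂ E] {α : Type*} [Fintype α] {v : α → E}

/-! ## §1 The entries map `u ↦ (⟪v_b, u⟫)_b` is a linear isomorphism `W ≃ ℂ^α` -/

omit [Fintype α] in
/-- A vector of `W = span {v_b}` orthogonal to every `v_b` is zero. [cite: HornJohnson2013, §0.6] -/
theorem eq_zero_of_inner_span_eq_zero (u : ↥(Submodule.span ℂ (Set.range v)))
    (h : ∀ b, ⟪(⟨v b, Submodule.subset_span ⟨b, rfl⟩⟩ : ↥(Submodule.span ℂ (Set.range v))), u⟫_ℂ = 0) : u = 0 := by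
  have hle : Submodule.span ℂ (Set.range v) ≤ (ℂ ∙ (u : E))ᗮ := Submodule.span_le.2 (by
    rintro _ ⟨b, rfl⟩
    exact Submodule.mem_orthogonal_singleton_iff_inner_left.2 (h b))
  have h0 : ⟪(u : E), (u : E)⟫_ℂ = 0 := Submodule.mem_orthogonal_singleton_iff_inner_left.1 (hle u.2)
  exact_mod_cast (inner_self_eq_zero.1 h0 : (u : E) = 0)

/-- **THE ENTRIES ISOMORPHISM**: for `v` linearly independent, `u ↦ (⟪v_b, u⟫_W)_b` is a linear isomorphism `W = span {v_a} ≃ₗ[ℂ] (α → ℂ)` (injective by `eq_zero_of_inner_span_eq_zero`,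
`dim W = |α|`). [cite: HornJohnson2013, §0.6, Thm. 7.2.10] -/
theorem exists_entriesEquiv (hv : LinearIndependent ℂ v) :
    ∃ Φ : ↥(Submodule.span ℂ (Set.range v)) ≃ₗ[ℂ] (α → ℂ), ∀ u b, Φ u b = ⟪(⟨v b, Submodule.subset_span ⟨b, rfl⟩⟩ : ↥(Submodule.span ℂ (Set.range v))), u⟫_ℂ := by
  let Φ : ↥(Submodule.span ℂ (Set.range v)) →ₗ[ℂ] (α → ℂ) :=
    LinearMap.pi fun b => (innerₛₗ ℂ (⟨v b, Submodule.subset_span ⟨b, rfl⟩⟩ : ↥(Submodule.span ℂ (Set.range v))) : ↥(Submodule.span ℂ (Set.range v)) →ₗ[ℂ] ℂ)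
  have hΦ : ∀ u b, Φ u b = ⟪(⟨v b, Submodule.subset_span ⟨b, rfl⟩⟩ : ↥(Submodule.span ℂ (Set.range v))), u⟫_ℂ := fun u b => rfl
  have hinj : Function.Injective Φ := by
    rw [← LinearMap.ker_eq_bot, LinearMap.ker_eq_bot']
    intro u hu
    exact eq_zero_of_inner_span_eq_zero u fun b => by rw [← hΦ, hu]; rfl
  haveI : FiniteDimensional ℂ ↥(Submodule.span ℂ (Set.range v)) := FiniteDimensional.span_of_finite ℂ (Set.finite_range v)
  have hrank : finrank ℂ ↥(Submodule.span ℂ (Set.range v)) = finrank ℂ (α → ℂ) := by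
    rw [finrank_span_eq_card hv, Module.finrank_fintype_fun_eq_card]
  have hsurj : Function.Surjective Φ := (LinearMap.injective_iff_surjective_of_finrank_eq_finrank hrank).1 hinj
  exact ⟨LinearEquiv.ofBijective Φ ⟨hinj, hsurj⟩, fun u b => rfl⟩

/-! ## §2 The operator with prescribed entries: existence, uniqueness, families -/

/-- **EXISTENCE — the operator on `W = span {v_a}` with prescribed entries**: for `v` linearly independent and any matrix `β`, there is `M ∈ End_ℂ W` with **`⟪v_b, M v_a⟫_W = β a b`** for
all `a, b` (`M v_a := Φ⁻¹(β(a, ·))` extended linearly by the basis `v` of `W`).  This is how the intertwining datum `M(z)` of ★ `exists_linearIsometry_chiSection_selfDual_cm_two` is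
DEFINED at rank `> 1` from the analytic entries `B_z(φ_a, φ_b)`. [cite: HornJohnson2013, §0.6] [cite: MoeglinWaldspurger1995, IV.1.11] -/
theorem exists_linearMap_span_of_entries (hv : LinearIndependent ℂ v) (β : α → α → ℂ) :
    ∃ M : ↥(Submodule.span ℂ (Set.range v)) →ₗ[ℂ] ↥(Submodule.span ℂ (Set.range v)),
      ∀ a b, ⟪(⟨v b, Submodule.subset_span ⟨b, rfl⟩⟩ : ↥(Submodule.span ℂ (Set.range v))), M ⟨v a, Submodule.subset_span ⟨a, rfl⟩⟩⟫_ℂ = β a b := by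
  obtain ⟨Φ, hΦ⟩ := exists_entriesEquiv hv
  refine ⟨(Basis.span hv).constr ℂ fun a => Φ.symm (fun b => β a b), fun a b => ?_⟩
  have hbw : (Basis.span hv) a = (⟨v a, Submodule.subset_span ⟨a, rfl⟩⟩ : ↥(Submodule.span ℂ (Set.range v))) := Basis.span_apply hv a
  rw [← hbw, Basis.constr_basis, ← hΦ, LinearEquiv.apply_symm_apply]

omit [Fintype α] in
/-- **UNIQUENESS — an operator on `W = span {v_a}` is determined by its entries `⟪v_b, M v_a⟫_W`** (`v` linearly independent). [cite: HornJohnson2013, §0.6] -/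
theorem eq_of_span_entries_eq (hv : LinearIndependent ℂ v) {M N : ↥(Submodule.span ℂ (Set.range v)) →ₗ[ℂ] ↥(Submodule.span ℂ (Set.range v))}
    (h : ∀ a b, ⟪(⟨v b, Submodule.subset_span ⟨b, rfl⟩⟩ : ↥(Submodule.span ℂ (Set.range v))), M ⟨v a, Submodule.subset_span ⟨a, rfl⟩⟩⟫_ℂ =
      ⟪(⟨v b, Submodule.subset_span ⟨b, rfl⟩⟩ : ↥(Submodule.span ℂ (Set.range v))), N ⟨v a, Submodule.subset_span ⟨a, rfl⟩⟩⟫_ℂ) : M = N := by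
  refine (Basis.span hv).ext fun a => ?_
  have hbw : (Basis.span hv) a = (⟨v a, Submodule.subset_span ⟨a, rfl⟩⟩ : ↥(Submodule.span ℂ (Set.range v))) := Basis.span_apply hv a
  rw [hbw]
  exact sub_eq_zero.1 (eq_zero_of_inner_span_eq_zero _ fun b => by rw [inner_sub_right, h a b, sub_self])

/-- **FAMILIES — prescribed entries depending on a parameter** (`x ↦ β_x`; E1: `z ↦ B_z(φ_a, φ_b)`, `c ↦` residue entries): `∃ M : X → End W`, `⟪v_b, M_x v_a⟫ = β_x a b`.
[cite: HornJohnson2013, §0.6] -/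
theorem exists_family_span_of_entries (hv : LinearIndependent ℂ v) {X : Type*} (β : X → α → α → ℂ) :
    ∃ M : X → ↥(Submodule.span ℂ (Set.range v)) →ₗ[ℂ] ↥(Submodule.span ℂ (Set.range v)),
      ∀ x a b, ⟪(⟨v b, Submodule.subset_span ⟨b, rfl⟩⟩ : ↥(Submodule.span ℂ (Set.range v))), M x ⟨v a, Submodule.subset_span ⟨a, rfl⟩⟩⟫_ℂ = β x a b := by
  choose M hM using fun x => exists_linearMap_span_of_entries hv (β x)
  exact ⟨M, hM⟩

/-! ## §3 Sesquilinear identities from entries (`hadj`, `hRsymm` at rank `> 1`) -/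

omit [Fintype α] in
/-- **SESQUILINEAR-BY-ENTRIES**: if `⟪v_b, M v_a⟫ = ⟪N v_b, v_a⟫` for all `a, b` (`v` linearly independent), then `⟪u, M u′⟫ = ⟪N u, u′⟫` for ALL `u, u′ ∈ W` — two sesquilinear forms
agreeing on basis pairs agree. [cite: HornJohnson2013, §0.6] -/
theorem inner_map_eq_inner_map_of_span_entries (hv : LinearIndependent ℂ v) {M N : ↥(Submodule.span ℂ (Set.range v)) →ₗ[ℂ] ↥(Submodule.span ℂ (Set.range v))}
    (h : ∀ a b, ⟪(⟨v b, Submodule.subset_span ⟨b, rfl⟩⟩ : ↥(Submodule.span ℂ (Set.range v))), M ⟨v a, Submodule.subset_span ⟨a, rfl⟩⟩⟫_ℂ =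
      ⟪N ⟨v b, Submodule.subset_span ⟨b, rfl⟩⟩, (⟨v a, Submodule.subset_span ⟨a, rfl⟩⟩ : ↥(Submodule.span ℂ (Set.range v)))⟫_ℂ)
    (u u' : ↥(Submodule.span ℂ (Set.range v))) : ⟪u, M u'⟫_ℂ = ⟪N u, u'⟫_ℂ := by
  have hbw : ∀ a, (Basis.span hv) a = (⟨v a, Submodule.subset_span ⟨a, rfl⟩⟩ : ↥(Submodule.span ℂ (Set.range v))) := fun a => Basis.span_apply hv a
  have key : ((innerₛₗ ℂ).compl₂ M : ↥(Submodule.span ℂ (Set.range v)) →ₗ⋆[ℂ] ↥(Submodule.span ℂ (Set.range v)) →ₗ[ℂ] ℂ) = (innerₛₗ ℂ).comp N := by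
    refine LinearMap.ext_basis (Basis.span hv) (Basis.span hv) fun i j => ?_
    rw [LinearMap.compl₂_apply, LinearMap.comp_apply, innerₛₗ_apply_apply, innerₛₗ_apply_apply, hbw, hbw]
    exact h j i
  have hk := LinearMap.congr_fun (LinearMap.congr_fun key u) u'
  rwa [LinearMap.compl₂_apply, LinearMap.comp_apply, innerₛₗ_apply_apply, innerₛₗ_apply_apply] at hk

omit [Fintype α] in
/-- **`hadj` OF ★ `exists_linearIsometry_chiSection_selfDual_cm_two` FROM ENTRIES**: `⟪v_b, M(z)v_a⟫ = ⟪M(z̄)v_b, v_a⟫` on entries (off `P`) ⇒ `⟪u, M(z)u′⟫ = ⟪M(z̄)u, u′⟫` on `W`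
(MW II.1.8 adjointness read in the model). [cite: MoeglinWaldspurger1995, IV.1.11] -/
theorem hadj_of_span_entries (hv : LinearIndependent ℂ v) {M : ℂ → ↥(Submodule.span ℂ (Set.range v)) →ₗ[ℂ] ↥(Submodule.span ℂ (Set.range v))} {P : Set ℂ}
    (h : ∀ z : ℂ, z ∉ P → conj z ∉ P → ∀ a b, ⟪(⟨v b, Submodule.subset_span ⟨b, rfl⟩⟩ : ↥(Submodule.span ℂ (Set.range v))), M z ⟨v a, Submodule.subset_span ⟨a, rfl⟩⟩⟫_ℂ =
      ⟪M (conj z) ⟨v b, Submodule.subset_span ⟨b, rfl⟩⟩, (⟨v a, Submodule.subset_span ⟨a, rfl⟩⟩ : ↥(Submodule.span ℂ (Set.range v)))⟫_ℂ) :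
    ∀ z : ℂ, z ∉ P → conj z ∉ P → ∀ u u' : ↥(Submodule.span ℂ (Set.range v)), ⟪u, M z u'⟫_ℂ = ⟪M (conj z) u, u'⟫_ℂ :=
  fun z hz hz' => inner_map_eq_inner_map_of_span_entries hv (h z hz hz')

omit [Fintype α] in
/-- **`hRsymm` FROM ENTRIES**: `⟪v_b, R_c v_a⟫ = ⟪R_c v_b, v_a⟫` on entries (`c ∈ S`) ⇒ `R_c` symmetric on `W`. [cite: MoeglinWaldspurger1995, IV.1.11] -/
theorem hRsymm_of_span_entries (hv : LinearIndependent ℂ v) {R : ℝ → ↥(Submodule.span ℂ (Set.range v)) →ₗ[ℂ] ↥(Submodule.span ℂ (Set.range v))} {S : Finset ℝ}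
    (h : ∀ c ∈ S, ∀ a b, ⟪(⟨v b, Submodule.subset_span ⟨b, rfl⟩⟩ : ↥(Submodule.span ℂ (Set.range v))), R c ⟨v a, Submodule.subset_span ⟨a, rfl⟩⟩⟫_ℂ =
      ⟪R c ⟨v b, Submodule.subset_span ⟨b, rfl⟩⟩, (⟨v a, Submodule.subset_span ⟨a, rfl⟩⟩ : ↥(Submodule.span ℂ (Set.range v)))⟫_ℂ) :
    ∀ c ∈ S, ∀ u u' : ↥(Submodule.span ℂ (Set.range v)), ⟪u, R c u'⟫_ℂ = ⟪R c u, u'⟫_ℂ :=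
  fun c hc => inner_map_eq_inner_map_of_span_entries hv (h c hc)

/-! ## §4 Continuity from entries (`hcont` at rank `> 1`) -/

/-- **CONTINUITY-BY-ENTRIES**: if every entry `x ↦ ⟪v_b, M_x v_a⟫` is continuous (`v` linearly independent), then `x ↦ M_x u` is continuous for every `u ∈ W` (`M_x v_a = Φ⁻¹(entries)` with
`Φ⁻¹` continuous on the finite-dimensional `ℂ^α`, and `u = Σ_a c_a v_a`). [cite: HornJohnson2013, §0.6] -/
theorem continuous_apply_of_span_entries (hv : LinearIndependent ℂ v) {X : Type*} [TopologicalSpace X]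
    {M : X → ↥(Submodule.span ℂ (Set.range v)) →ₗ[ℂ] ↥(Submodule.span ℂ (Set.range v))}
    (h : ∀ a b, Continuous fun x => ⟪(⟨v b, Submodule.subset_span ⟨b, rfl⟩⟩ : ↥(Submodule.span ℂ (Set.range v))), M x ⟨v a, Submodule.subset_span ⟨a, rfl⟩⟩⟫_ℂ)
    (u : ↥(Submodule.span ℂ (Set.range v))) : Continuous fun x => M x u := by
  haveI : FiniteDimensional ℂ ↥(Submodule.span ℂ (Set.range v)) := FiniteDimensional.span_of_finite ℂ (Set.finite_range v)
  obtain ⟨Φ, hΦ⟩ := exists_entriesEquiv hv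
  have hbw : ∀ a, (Basis.span hv) a = (⟨v a, Submodule.subset_span ⟨a, rfl⟩⟩ : ↥(Submodule.span ℂ (Set.range v))) := fun a => Basis.span_apply hv a
  -- each `x ↦ M_x v_a` is `Φ⁻¹ ∘ (entries)`
  have ha : ∀ a, Continuous fun x => M x ⟨v a, Submodule.subset_span ⟨a, rfl⟩⟩ := fun a => by
    have h1 : ∀ x, M x ⟨v a, Submodule.subset_span ⟨a, rfl⟩⟩ =
        Φ.toContinuousLinearEquiv.symm (fun b => ⟪(⟨v b, Submodule.subset_span ⟨b, rfl⟩⟩ : ↥(Submodule.span ℂ (Set.range v))), M x ⟨v a, Submodule.subset_span ⟨a, rfl⟩⟩⟫_ℂ) := fun x => by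
      rw [eq_comm, ContinuousLinearEquiv.symm_apply_eq]
      funext b
      rw [LinearEquiv.coe_toContinuousLinearEquiv', hΦ]
    exact (Φ.toContinuousLinearEquiv.symm.continuous.comp (continuous_pi fun b => h a b)).congr fun x => (h1 x).symm
  -- expand `u` on the basis `v`
  have hu : (fun x => M x u) = fun x => ∑ a, (Basis.span hv).repr u a • M x ⟨v a, Submodule.subset_span ⟨a, rfl⟩⟩ := by
    funext x
    conv_lhs => rw [← (Basis.span hv).sum_repr u]
    rw [map_sum]
    refine Finset.sum_congr rfl fun a _ => ?_
    rw [map_smul, hbw]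
  rw [hu]
  exact continuous_finsetSum _ fun a _ => ((ha a).const_smul ((Basis.span hv).repr u a)).congr fun x => rfl

/-- **`hcont` OF ★ `exists_linearIsometry_chiSection_selfDual_cm_two` FROM ENTRIES**: continuity of the entries `t ↦ ⟪v_b, M(½+it)v_a⟫` on the unitary axis ⇒ `t ↦ M(½+it)u` continuous
for every `u ∈ W`. [cite: MoeglinWaldspurger1995, IV.1.11] -/
theorem hcont_of_span_entries (hv : LinearIndependent ℂ v) {M : ℂ → ↥(Submodule.span ℂ (Set.range v)) →ₗ[ℂ] ↥(Submodule.span ℂ (Set.range v))}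
    (h : ∀ a b, Continuous fun t : ℝ => ⟪(⟨v b, Submodule.subset_span ⟨b, rfl⟩⟩ : ↥(Submodule.span ℂ (Set.range v))), M ((((1 / 2 : ℝ)) : ℂ) + t * I) ⟨v a, Submodule.subset_span ⟨a, rfl⟩⟩⟫_ℂ) :
    ∀ u : ↥(Submodule.span ℂ (Set.range v)), Continuous fun t : ℝ => M ((((1 / 2 : ℝ)) : ℂ) + t * I) u :=
  fun u => continuous_apply_of_span_entries hv (M := fun t : ℝ => M ((((1 / 2 : ℝ)) : ℂ) + t * I)) h u

end Summit.HodgeConjecture.HodgeConjecture.Cruxes.H413.K2E1SpanOperatorOfEntries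

end
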